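import Summits.KontsevichZagierPeriods.KontsevichZagierPeriods.Theorems.TorsionLogsTorsionSectorCompleteArcFibreIdentity
import Summits.KontsevichZagierPeriods.KontsevichZagierPeriods.Theorems.TorsionLogsTorsionSectorCompleteArcFubini
import Summits.KontsevichZagierPeriods.KontsevichZagierPeriods.Theorems.HyperbolicBlochOffTetraSectorKernelStubDescend

/-!
# The modular-arc value identity (route `TorsionLogs`, crux `TorsionSectorComplete`,
# stmt-KontsevichZagierPeriods-14212, line `NeronTorsionModularArc`, rung `NeronTorsionArcs`)

The on-path workfile `Cruxes/TorsionSectorComplete/Lines/NeronTorsionArcs_onpath.lean` of the registered line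
`NeronTorsionModularArc` reduces the forward discipline's F4 lemma `KontsevichZagierPeriods → NeronTorsionArcs`
to ONE real-analytic identity, `ArcValueIdentity`:
`(N−2)(4N²·R_I.value + (N−2a)²·R_P.value) = 4N·R_ψ.value − N²(N−2)·R_D.value`
for the two dimension-3 representations `R_I`, `R_P` fibred over a real arc `t₀ < t < t₁` of the pencil
`f_t(x) = 4x³ − t x − (4e₁³ − t e₁)` (parameter `t = z 2` last; fibres = the floor's triangle / quadrant
representations) and the two log boxes `R_ψ = ∫∫ (A_N(t)−1)/(1+u(A_N(t)−1))`, `R_D` (same with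
`D(t) = 3e₁² − t/4`), `A_N(t) = |ψ_{N−1}(x_P(t), y_P(t)/2)|`.

This file PROVES it — `arc_value_identity`, stated on the raw data (curried hypotheses, the pencil `f`, the
carriers `A`, `D` as functions with their defining equations), so that no crux-local definition is needed;
the Theorems-side mirror `TorsionLogsTorsionSectorCompleteDefs.lean :: NeronArcs.ArcValueIdentity` is then a
one-line repackaging.  Proof = the lander's route of the line card, no new mathematics:
(1) Fubini over the LAST coordinate (`integral_integral_lastSlice`, `ae_integrableOn_lastSlice`,
`integrable_integral_lastSlice` of `TorsionLogsTorsionSectorCompleteArcFubini.lean`, prover-fwd2-land-3-g27-0):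
`R_I.value = ∫_{t₀}^{t₁} I(t) dt` with `I(t)` the iterated triangle integral (a.e. slice, `setIntegral_triangle_eq`),
`R_P.value = ∫ ω(t)E(t) dt` (`setIntegral_quadrant_eq`), the slices over `t ∉ (t₀,t₁)` being empty;
(2) the RAW fibre identity `neronTorsion_raw_identity` (`TorsionLogsTorsionSectorCompleteArcFibreIdentity.lean`)
at every `t` of the arc, with `g₂ = t`, `g₃ = 4e₁³ − t e₁`, `y_P = √f_t(x_P(t))`, which also gives `A_N(t) > 0`,
`D(t) > 0` there; (3) the log boxes `R_ψ.value = ∫ log A_N`, `R_D.value = ∫ log D` (`value_logBox_eq`,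
`integrableOn_log_of_logBox`); (4) integrate (2) over the arc (linearity, all four fibre functions integrable).
[Silverman 1994 (ATAEC) Thm VI.1.1, VI.3.2; Kontsevich–Zagier 2001 §1.1]

prover-fwd2-land-1-g28-0 (on-path lander, row owner of candidates row 8), 2026-08-19.
-/

-- single-conjunct summit: Sub = Summit, so the namespace segment repeats by design (CONVENTIONS §2)
set_option linter.dupNamespace false

noncomputable section

open Set MeasureTheory
open Literature.NumberTheory.Transcendental
open Summit.KontsevichZagierPeriods.KontsevichZagierPeriods.TorsionLogs.NeronTorsionModularArc
  (integral_integral_lastSlice integrable_integral_lastSlice ae_integrableOn_lastSlice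
    setIntegral_triangle_eq setIntegral_quadrant_eq value_logBox_eq integrableOn_log_of_logBox)
open Summit.KontsevichZagierPeriods.HyperbolicBloch.OffTetraSectorKernel
  (descend_snoc_zero descend_snoc_one descend_snoc_two)

namespace Summit.KontsevichZagierPeriods.KontsevichZagierPeriods.TorsionLogs.NeronArcs

/-! ### Linear bookkeeping of integrals over the arc -/

/-- If `c₁(c₂ I + c₃ V) = c₄ L_A − c₅ L_D` pointwise on a measurable set `S` for four functions integrable
on `S`, the same identity holds between their integrals over `S`. [folklore] -/
theorem integral_combination_eq {μ : Measure ℝ} {I V LA LD : ℝ → ℝ} {c₁ c₂ c₃ c₄ c₅ : ℝ} {S : Set ℝ}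
    (hS : MeasurableSet S) (hI : IntegrableOn I S μ) (hV : IntegrableOn V S μ)
    (hA : IntegrableOn LA S μ) (hD : IntegrableOn LD S μ)
    (h : ∀ s ∈ S, c₁ * (c₂ * I s + c₃ * V s) = c₄ * LA s - c₅ * LD s) :
    c₁ * (c₂ * (∫ s in S, I s ∂μ) + c₃ * ∫ s in S, V s ∂μ) =
      c₄ * (∫ s in S, LA s ∂μ) - c₅ * ∫ s in S, LD s ∂μ := by
  have h1 : ∫ s in S, c₁ * (c₂ * I s + c₃ * V s) ∂μ = ∫ s in S, (c₄ * LA s - c₅ * LD s) ∂μ :=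
    setIntegral_congr_fun hS h
  rw [integral_const_mul, integral_add (hI.const_mul c₂) (hV.const_mul c₃), integral_const_mul,
    integral_const_mul, integral_sub (hA.const_mul c₄) (hD.const_mul c₅), integral_const_mul,
    integral_const_mul] at h1
  exact h1

/-! ### The value identity -/

/-- **The modular-arc value identity** (raw form of `ArcValueIdentity` of line `NeronTorsionModularArc`).
Data: `e₁ > 0`; the pencil `f t x = 4x³ − t x − (4e₁³ − t e₁)`; an arc `(t₀, t₁)` on which `Δ(t) ≠ 0`, `f_t > 0`
on `(e₁, ∞)` and a section `x_P(t) > e₁` with `N·∫_{x_P(t)}^∞ dx/√f_t = a·2∫_{e₁}^∞ dx/√f_t` (`N ≥ 3`); the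
carriers `A(t) = |ψ_{N−1}(x_P(t), √f_t(x_P(t))/2)|`, `D(t) = 3e₁² − t/4`; representations `R_I`, `R_P`
(dimension 3, fibred over the arc with `t = z 2`: triangle `e₁ < z 1 < z 0 < x_P(t)` with
`z 1/(√f_t(z 1)√f_t(z 0))`, quadrant `z 0, z 1 > e₁` with `(√f_t(z 0))⁻¹(t z 1 + 2g₃(t))/(2 z 1²√f_t(z 1))`)
and `R_ψ`, `R_D` (dimension 2, the log boxes of `A`, `D` over `0 < w 0 < 1`, `t₀ < w 1 < t₁`).  Then
`(N−2)(4N²·R_I.value + (N−2a)²·R_P.value) = 4N·R_ψ.value − N²(N−2)·R_D.value`.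
Fubini over the last coordinate + the raw fibrewise Néron–torsion identity + `∫₀¹ (B−1)/(1+u(B−1)) du = log B`.
[cite: Silverman1994, Thm VI.1.1, Thm VI.3.2] -/
theorem arc_value_identity (e₁ t₀ t₁ : ℝ) (N a : ℕ) (xP : ℝ → ℝ) (f : ℝ → ℝ → ℝ) (A D : ℝ → ℝ)
    (hf : ∀ t x, f t x = 4 * x ^ 3 - t * x - (4 * e₁ ^ 3 - t * e₁))
    (hA : ∀ t, A t = |((⟨0, 0, 0, -t / 4, -(4 * e₁ ^ 3 - t * e₁) / 4⟩ : WeierstrassCurve ℝ).ψ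
        ((N : ℤ) - 1)).evalEval (xP t) (Real.sqrt (f t (xP t)) / 2)|)
    (hD : ∀ t, D t = 3 * e₁ ^ 2 - t / 4)
    (he₁ : 0 < e₁) (hN : 3 ≤ N)
    (hΔ : ∀ t ∈ Ioo t₀ t₁, t ^ 3 - 27 * (4 * e₁ ^ 3 - t * e₁) ^ 2 ≠ 0)
    (hpos : ∀ t ∈ Ioo t₀ t₁, ∀ x, e₁ < x → 0 < f t x)
    (hxP : ∀ t ∈ Ioo t₀ t₁, e₁ < xP t)
    (hper : ∀ t ∈ Ioo t₀ t₁, (N : ℝ) * (∫ x in Ioi (xP t), (Real.sqrt (f t x))⁻¹) =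
      a * (2 * ∫ x in Ioi e₁, (Real.sqrt (f t x))⁻¹))
    (RI RP : KZ.IntegralRep 3) (Rψ RD : KZ.IntegralRep 2)
    (hIdom : RI.domain = {z | t₀ < z 2 ∧ z 2 < t₁ ∧ e₁ < z 1 ∧ z 1 < z 0 ∧ z 0 < xP (z 2)})
    (hIint : EqOn RI.integrand
      (fun z => z 1 / (Real.sqrt (f (z 2) (z 1)) * Real.sqrt (f (z 2) (z 0)))) RI.domain)
    (hPdom : RP.domain = {z | t₀ < z 2 ∧ z 2 < t₁ ∧ e₁ < z 0 ∧ e₁ < z 1})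
    (hPint : EqOn RP.integrand
      (fun z => (Real.sqrt (f (z 2) (z 0)))⁻¹ *
        ((z 2 * z 1 + 2 * (4 * e₁ ^ 3 - z 2 * e₁)) / (2 * (z 1) ^ 2 * Real.sqrt (f (z 2) (z 1)))))
      RP.domain)
    (hψdom : Rψ.domain = {w | 0 < w 0 ∧ w 0 < 1 ∧ t₀ < w 1 ∧ w 1 < t₁})
    (hψint : EqOn Rψ.integrand (fun w => (A (w 1) - 1) / (1 + w 0 * (A (w 1) - 1))) Rψ.domain)
    (hDdom : RD.domain = {w | 0 < w 0 ∧ w 0 < 1 ∧ t₀ < w 1 ∧ w 1 < t₁})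
    (hDint : EqOn RD.integrand (fun w => (D (w 1) - 1) / (1 + w 0 * (D (w 1) - 1))) RD.domain) :
    ((N : ℝ) - 2) * (4 * (N : ℝ) ^ 2 * RI.value + ((N : ℝ) - 2 * a) ^ 2 * RP.value) =
      4 * (N : ℝ) * Rψ.value - (N : ℝ) ^ 2 * ((N : ℝ) - 2) * RD.value := by
  -- (2) fibrewise on the arc: positivity of the carriers and the raw Néron–torsion identity
  have hfib : ∀ t ∈ Ioo t₀ t₁, 0 < A t ∧ 0 < D t ∧
      ((N : ℝ) - 2) * (4 * (N : ℝ) ^ 2 *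
            (∫ x in Ioo e₁ (xP t), (∫ y in Ioo e₁ x, y / Real.sqrt (f t y)) * (Real.sqrt (f t x))⁻¹) +
          ((N : ℝ) - 2 * a) ^ 2 *
            ((∫ x in Ioi e₁, (Real.sqrt (f t x))⁻¹) *
              (∫ x in Ioi e₁, (t * x + 2 * (4 * e₁ ^ 3 - t * e₁)) / (2 * x ^ 2 * Real.sqrt (f t x))))) =
        4 * (N : ℝ) * Real.log (A t) - (N : ℝ) ^ 2 * ((N : ℝ) - 2) * Real.log (D t) := by
    intro t ht
    have hsq : Real.sqrt (f t (xP t)) ^ 2 = f t (xP t) :=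
      Real.sq_sqrt (hpos t ht _ (hxP t ht)).le
    have hfe : f t e₁ = 0 := by rw [hf]; ring
    rw [hA t, hD t]
    exact neronTorsion_raw_identity t (4 * e₁ ^ 3 - t * e₁) e₁ (xP t) (Real.sqrt (f t (xP t))) N a (f t)
      (hf t) (hΔ t ht) hfe he₁ (hpos t ht) (hxP t ht) hsq hN (hper t ht)
  have hApos : ∀ t ∈ Ioo t₀ t₁, 0 < A t := fun t ht => (hfib t ht).1
  have hDpos : ∀ t ∈ Ioo t₀ t₁, 0 < D t := fun t ht => (hfib t ht).2.1
  -- (3) the two log boxes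
  have hψv : Rψ.value = ∫ t in Ioo t₀ t₁, Real.log (A t) := value_logBox_eq A t₀ t₁ Rψ hψdom hψint hApos
  have hDv : RD.value = ∫ t in Ioo t₀ t₁, Real.log (D t) := value_logBox_eq D t₀ t₁ RD hDdom hDint hDpos
  have hψi : IntegrableOn (fun t => Real.log (A t)) (Ioo t₀ t₁) :=
    integrableOn_log_of_logBox A t₀ t₁ Rψ hψdom hψint hApos
  have hDi : IntegrableOn (fun t => Real.log (D t)) (Ioo t₀ t₁) :=
    integrableOn_log_of_logBox D t₀ t₁ RD hDdom hDint hDpos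
  -- (1b) the fibred quadrant representation `R_P`: every slice
  have hPm : MeasurableSet RP.domain := KZ.IntegralRep.measurableSet_domain_holds RP
  have hPslice : ∀ s : ℝ,
      (∫ x in {x : Fin 2 → ℝ | (Fin.snoc x s : Fin 3 → ℝ) ∈ RP.domain}, RP.integrand (Fin.snoc x s)) =
        (Ioo t₀ t₁).indicator (fun s => (∫ x in Ioi e₁, (Real.sqrt (f s x))⁻¹) *
          (∫ x in Ioi e₁, (s * x + 2 * (4 * e₁ ^ 3 - s * e₁)) / (2 * x ^ 2 * Real.sqrt (f s x)))) s := by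
    intro s
    by_cases hs : s ∈ Ioo t₀ t₁
    · rw [indicator_of_mem hs]
      have hset : {x : Fin 2 → ℝ | (Fin.snoc x s : Fin 3 → ℝ) ∈ RP.domain} =
          {x : Fin 2 → ℝ | e₁ < x 0 ∧ e₁ < x 1} := by
        ext x
        simp only [mem_setOf_eq, hPdom, descend_snoc_zero, descend_snoc_one,
          descend_snoc_two, hs.1, hs.2, true_and]
      rw [hset]
      refine setIntegral_quadrant_eq e₁ e₁ (fun x => (Real.sqrt (f s x))⁻¹)
        (fun x => (s * x + 2 * (4 * e₁ ^ 3 - s * e₁)) / (2 * x ^ 2 * Real.sqrt (f s x)))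
        (fun x => RP.integrand (Fin.snoc x s)) ?_
      intro x hx
      have hmem : (Fin.snoc x s : Fin 3 → ℝ) ∈ RP.domain := by
        rw [hPdom]
        simp only [mem_setOf_eq, descend_snoc_zero, descend_snoc_one, descend_snoc_two]
        exact ⟨hs.1, hs.2, hx.1, hx.2⟩
      simp only [hPint hmem, descend_snoc_zero, descend_snoc_one, descend_snoc_two]
    · rw [indicator_of_notMem hs]
      have hset : {x : Fin 2 → ℝ | (Fin.snoc x s : Fin 3 → ℝ) ∈ RP.domain} = ∅ := by
        ext x
        simp only [mem_setOf_eq, hPdom, descend_snoc_two, mem_empty_iff_false, iff_false]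
        exact fun h => hs ⟨h.1, h.2.1⟩
      rw [hset, setIntegral_empty]
  have hPv : RP.value = ∫ s in Ioo t₀ t₁, (∫ x in Ioi e₁, (Real.sqrt (f s x))⁻¹) *
      (∫ x in Ioi e₁, (s * x + 2 * (4 * e₁ ^ 3 - s * e₁)) / (2 * x ^ 2 * Real.sqrt (f s x))) := by
    rw [KZ.IntegralRep.value, ← integral_integral_lastSlice hPm RP.integrableOn,
      integral_congr_ae (Filter.Eventually.of_forall hPslice), integral_indicator measurableSet_Ioo]
  have hPi : IntegrableOn (fun s => (∫ x in Ioi e₁, (Real.sqrt (f s x))⁻¹) *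
      (∫ x in Ioi e₁, (s * x + 2 * (4 * e₁ ^ 3 - s * e₁)) / (2 * x ^ 2 * Real.sqrt (f s x))))
      (Ioo t₀ t₁) :=
    (integrable_indicator_iff measurableSet_Ioo).mp
      ((integrable_integral_lastSlice hPm RP.integrableOn).congr (Filter.Eventually.of_forall hPslice))
  -- (1a) the fibred triangle representation `R_I`: almost every slice
  have hIm : MeasurableSet RI.domain := KZ.IntegralRep.measurableSet_domain_holds RI
  have hIslice : ∀ᵐ s : ℝ,
      (∫ x in {x : Fin 2 → ℝ | (Fin.snoc x s : Fin 3 → ℝ) ∈ RI.domain}, RI.integrand (Fin.snoc x s)) =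
        (Ioo t₀ t₁).indicator (fun s =>
          ∫ x in Ioo e₁ (xP s), (∫ y in Ioo e₁ x, y / Real.sqrt (f s y)) * (Real.sqrt (f s x))⁻¹) s := by
    filter_upwards [ae_integrableOn_lastSlice hIm RI.integrableOn] with s hsi
    by_cases hs : s ∈ Ioo t₀ t₁
    · rw [indicator_of_mem hs]
      have hset : {x : Fin 2 → ℝ | (Fin.snoc x s : Fin 3 → ℝ) ∈ RI.domain} =
          {x : Fin 2 → ℝ | e₁ < x 1 ∧ x 1 < x 0 ∧ x 0 < xP s} := by
        ext x
        simp only [mem_setOf_eq, hIdom, descend_snoc_zero, descend_snoc_one,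
          descend_snoc_two, hs.1, hs.2, true_and]
      rw [hset] at hsi ⊢
      refine setIntegral_triangle_eq (xP s) e₁ (f s) (fun x => RI.integrand (Fin.snoc x s)) hsi ?_
      intro x hx
      have hmem : (Fin.snoc x s : Fin 3 → ℝ) ∈ RI.domain := by
        rw [hIdom]
        simp only [mem_setOf_eq, descend_snoc_zero, descend_snoc_one, descend_snoc_two]
        exact ⟨hs.1, hs.2, hx.1, hx.2.1, hx.2.2⟩
      simp only [hIint hmem, descend_snoc_zero, descend_snoc_one, descend_snoc_two]
    · rw [indicator_of_notMem hs]
      have hset : {x : Fin 2 → ℝ | (Fin.snoc x s : Fin 3 → ℝ) ∈ RI.domain} = ∅ := by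
        ext x
        simp only [mem_setOf_eq, hIdom, descend_snoc_two, mem_empty_iff_false, iff_false]
        exact fun h => hs ⟨h.1, h.2.1⟩
      rw [hset, setIntegral_empty]
  have hIv : RI.value = ∫ s in Ioo t₀ t₁,
      ∫ x in Ioo e₁ (xP s), (∫ y in Ioo e₁ x, y / Real.sqrt (f s y)) * (Real.sqrt (f s x))⁻¹ := by
    rw [KZ.IntegralRep.value, ← integral_integral_lastSlice hIm RI.integrableOn,
      integral_congr_ae hIslice, integral_indicator measurableSet_Ioo]
  have hIi : IntegrableOn (fun s =>
      ∫ x in Ioo e₁ (xP s), (∫ y in Ioo e₁ x, y / Real.sqrt (f s y)) * (Real.sqrt (f s x))⁻¹)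
      (Ioo t₀ t₁) :=
    (integrable_indicator_iff measurableSet_Ioo).mp
      ((integrable_integral_lastSlice hIm RI.integrableOn).congr hIslice)
  -- (4) integrate the fibre identity over the arc
  rw [hIv, hPv, hψv, hDv]
  exact integral_combination_eq measurableSet_Ioo hIi hPi hψi hDi (fun s hs => (hfib s hs).2.2)

end Summit.KontsevichZagierPeriods.KontsevichZagierPeriods.TorsionLogs.NeronArcs

end
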